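import Summits.ABC.IUTFork.Repair.RHHullThresholdExactRefute
import Summits.ABC.IUTFork.Conditional.AbcOfSGenuineKChosenDepth
import Summits.ABC.IUTFork.Cor312GenuineKDeepDatumLam
import Summits.ABC.IUTFork.Cor312GenuineKLocalTypeEven
import Summits.ABC.IUTFork.Cor312GenuineKLocalTypeThirty
import Summits.ABC.IUTFork.Repair.CandInternal2RealStrata
import Summits.ABC.IUTFork.Repair.CandInternal2RealSharp
import Literature.IUT.LogVolume.TensorPacketDifferentSharp
import Literature.IUT.LogVolume.DifferentEstimatesCorollaries
import Literature.IUT.LogVolume.TensorPacketFactorDifferent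
import HarnessLib

/-!
# Branch C / R-H × R-W «GENUINE-NEG» ENGINE through R-H row 4's FLOOR-EXACT hull threshold: at the HEX datum `λ_k = 1/2 + 2/7^k`, if the
# closed-form column `HullCell` FAILS at every admissible local type `e = l·d` (`d ∣ 15` for even `k`, `d ∣ 30` always), then S_H FAILS

PROOF-ONLY file (0 definitions, 0 `Prop` facts, no instance, no notation) of the abc-iut cell (seat abc-iut-rh-typ-4 gen 2; D-0079 rescue
sub-cell R-H, ROUND 1 PAIR n = 4 / round-2 kernel step for R-W lane U; plan g9 GO 18:40:07Z «NEG-side consumer of the U2 wrapper at the genuine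
HEX flips»). TAKES NO SIDE on [IUTchIII] Cor. 3.12 (S. Mochizuki, *Inter-universal Teichmüller theory III*, RIMS manuscript, Cor. 3.12
p. 173–174, Step (xi-f) p. 184) or on any author: every statement is about OUR typed objects (abc-iut-c312-7's `Thm311.Real.settingPrVolSharp`
at `Cor312Prov.pilotDataOfK`, abc-iut-c312-5's `presAt` / typed (Ind1)(Ind2), abc-iut-c312-1's `Thm311ToCor312.Licence`); the hull-level licence
is a STRONGER-THAN-PRINT reading of Step (xi-f); typed ≠ proved; refuted-as-typed ≠ refuted-in-print; nothing here asserts abc proved or refuted.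

WHAT. R-H row 4 «hull-threshold-exact» (`Repair.RH.HullThresholdExact.HullCell`, p458452 ✓) is the integer column of abc-iut-c312-5's exact
licence criterion at the DIAGONAL packet; this seat's `RH.HullThresholdExactRefute.not_licence_settingPrVolSharp_of_not_hullCell` (p462895 ✓)
turned abc-iut-w4-d036's U2-LICENCE-WRAPPER (`licence_settingPrVolSharp_iff_shellRadii_of_realises`, p460573 ✓) into «column FAILS at
certified radii bounds of ONE bad place ⟹ licence FAILS», leaving three local inputs per place BY NAME. THIS FILE discharges them at the genuine
`K`-line and packages the result as an ENGINE in the shape of the W-lane refutations (`HexDepthLocalType…`):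
* §1 (`HexHullThreshold.…`, any `K/ℚ_p`): `exists_innerRadius` (MAXIMAL inner radius; least admissible exponent, `closedBall_subset_logUnits` +
  `isCompact_logUnits`), `rpow_le_norm_of_innerRadius` (`p^{−r/e} ≤ ‖c‖` if `1/(p−1) < r/e`; `pBall_subset_logUnits_of_lt` p451708 + value group),
  `exists_outerRadius` (abc-iut-w6), `norm_le_rpow_of_mem_logUnits_turning` (`‖c‖ ≤ p^{−(p^{a₀} − a₀e)/e}`; `norm_le_rpow_sharp_of_mem_logUnits` p454995).
* §2 **`GenuineK.not_pilotKummerCompatHull_lamSeven_of_not_hullCell`** — `k ≥ 1`, `l ≥ 11` prime, `l ∤ k`, label `i + 1 ≤ l⋇`, EVERY genuine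
  Θ-volume datum `T` over `(ratPoint λ_k, l)` with `e(K_{x₀}/ℚ_7) ∣ B·l` at every `x₀ | 7` (abc-iut-w4-d087 `GenuineK.localType_lamSeven_fifteen`:
  `B = 15`, even `k`; abc-iut-W-neg-1 `GenuineK.localType_lamSeven_thirty`: `B = 30`): IF `¬ HullCell (l·d) (k·d) (i+1) (⌊l·d/6⌋+1) (7^{a₀} − a₀·l·d)`
  for every `d ∣ B` (`a₀` the turning point of `e = l·d`), THEN `¬ PilotKummerCompatHull` at the sharp genuine setting with the CHOSEN realising
  ideles and the PINNED reading, for every choice of the free binders (the per-datum instance shape of `hSHw` of `Conditional.abc_of_SH_v10K_window`).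
  The place is abc-iut-c312-7's `GenuineK.exists_place_lamSeven` (`‖t_q(x₀)‖ = 7^{−k/l}`, tame); `l ∣ e` by the value group; `P_q(x₀) = k·d` by
  `norm_qIdele_eq_rpow_of_realises`; tame different `d_{x₀} = (e−1)/e` (`differentOrd_eq_of_not_dvd`, `differentOrd_le_differentOrd_dFac`).
The row instances (`k ∈ {8,…,11}`, primes `11 ≤ l ≤ 71`) are filed separately (`Conditional/HexHullThresholdGenuineRows`).
SHARPER than the [ED]/[LIN] engines (p458737 etc.): it keeps the integrality of the levels `p^m` (the floor) and the exact different defect of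
the diagonal packet instead of the print constants `a_e, b_e` (seat-side exact scan = rw-num-lead's `verdict_U2cell` margins cell-for-cell; the
column fails at the top label for `k ∈ {8,…,11}` at every prime `11 ≤ l ≤ 71`, `l ∤ k` — outside every [LIN]/[ED] frontier of record).
HONEST SCOPE: SHARP reading; a failing top-label diagonal packet says NOTHING about the printed GLOBAL inequality, the number-level
`Cor22.Cor312AtDatum`, or any author's intended hull; HEX rows are Szpiro-GOOD (they test the WINDOW binder `hSHw` of the uncut records only);
admissibility `CondP6` of `(λ_k, l)` is NOT asserted (the theorem holds at every datum `T`); no side taken on any author; typed ≠ proved;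
refuted-as-typed ≠ refuted-in-print; no abc claim.
[cite: Mochizuki2012, IUTchIII Cor. 3.12 Step (xi-f) p. 184; IUTchIV Prop. 1.1 p. 9, Prop. 1.2 (i)(ii) p. 10, Cor. 2.2 (ii) proof (P5) p. 46]
[cite: DupuyHilado2025, §3.4, §4.9, §4.12] [cite: SerreLocalFields1979, Ch. III §6 Prop. 13] [cite: NeukirchANT1999, Ch. II (5.5)]
[claim: Mochizuki2012, status: disputed] for every IUT quotation.
-/

noncomputable section

open Set Function NumberField IsDedekindDomain

namespace Summit.ABC.IUTFork.Conditional

namespace HexHullThreshold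

open Literature.IUT.LogThetaLattice Literature.IUT.LogVolume Literature.NumberTheory.GaloisRepresentations.Ultrametric
  Summit.ABC.IUTFork.Repair.CandInternal2RealStrata Summit.ABC.IUTFork.Repair.CandInternal2RealSharp

/-! ## §1. Local lemmas: the inner and outer radii of `log_p(𝒪_K^×)` exist, with certified bounds -/

section Local

variable (p : ℕ) [Fact p.Prime]
variable (K : Type) [NontriviallyNormedField K] [NormedAlgebra ℚ_[p] K] [IsUltrametricDist K] [ProperSpace K]

include p in
/-- **The INNER radius of `log_p(𝒪_K^×)` exists**: a nonzero `c` with `c·𝒪_K ⊆ log_p(𝒪_K^×)` which is MAXIMAL — some `w ∉ log_p(𝒪_K^×)`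
has `‖w‖·‖ϖ‖ ≤ ‖c‖` for a norm uniformizer `ϖ` (the binders `hin0/hin/hmax` of abc-iut-w4-d036's U2-LICENCE-WRAPPER). Proof: the set of
exponents `n` with `ϖⁿ𝒪_K ⊆ log_p(𝒪_K^×)` is nonempty (`closedBall_subset_logUnits`) and bounded below (`isCompact_logUnits`); take its least
element. [cite: Mochizuki2012, IUTchIV Prop. 1.2 (i) p. 10] [claim: Mochizuki2012, status: disputed] -/
theorem exists_innerRadius :
    ∃ (c : K) (ϖ : Kˣ) (w : K), c ≠ 0 ∧ (∀ o : K, ‖o‖ ≤ 1 → c * o ∈ logUnits K) ∧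
      IsUniformizer ϖ ∧ w ∉ logUnits K ∧ ‖w‖ * ‖(ϖ : K)‖ ≤ ‖c‖ := by
  classical
  obtain ⟨ϖ, hϖ⟩ := exists_isUniformizer (F := K)
  have h0 : 0 < ‖(ϖ : K)‖ := norm_units_pos ϖ
  have h1 : ‖(ϖ : K)‖ < 1 := hϖ.1
  let P : ℤ → Prop := fun n => ∀ o : K, ‖o‖ ≤ ‖(ϖ : K)‖ ^ n → o ∈ logUnits K
  have hne : ∃ n : ℤ, P n := by
    have hp0 : (0 : ℝ) < (p : ℝ) ^ (-(2 : ℝ)) :=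
      Real.rpow_pos_of_pos (by exact_mod_cast (Fact.out : p.Prime).pos) _
    obtain ⟨n, hn⟩ := exists_pow_lt_of_lt_one hp0 h1
    refine ⟨(n : ℤ), fun o ho => closedBall_subset_logUnits p K ?_⟩
    rw [zpow_natCast] at ho
    exact le_trans ho hn.le
  have hbdd : ∃ b : ℤ, ∀ n : ℤ, P n → b ≤ n := by
    obtain ⟨R, hR⟩ := isBounded_iff_forall_norm_le.mp (isCompact_logUnits p K).isBounded
    obtain ⟨N, hN⟩ := pow_unbounded_of_one_lt R (one_lt_inv_iff₀.mpr ⟨h0, h1⟩)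
    refine ⟨-(N : ℤ), fun n hn => ?_⟩
    by_contra hlt
    push Not at hlt
    have hmem : ((ϖ : K) ^ n) ∈ logUnits K := hn _ (by rw [norm_zpow])
    have hle : ‖(ϖ : K)‖ ^ n ≤ R := by simpa only [norm_zpow] using hR _ hmem
    have hlt' : ‖(ϖ : K)‖ ^ (-(N : ℤ)) < ‖(ϖ : K)‖ ^ n := zpow_lt_zpow_right_of_lt_one₀ h0 h1 hlt
    rw [zpow_neg, zpow_natCast, ← inv_pow] at hlt'
    linarith
  obtain ⟨n₀, hn₀, hmin⟩ := Int.exists_least_of_bdd hbdd hne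
  -- maximality: `n₀ - 1` is not admissible
  have hnot : ¬ P (n₀ - 1) := fun h => by have := hmin _ h; omega
  simp only [P, not_forall, exists_prop] at hnot
  obtain ⟨w, hwle, hw⟩ := hnot
  refine ⟨(ϖ : K) ^ n₀, ϖ, w, zpow_ne_zero _ ϖ.ne_zero, fun o ho => hn₀ _ ?_, hϖ, hw, ?_⟩
  · rw [norm_mul, norm_zpow]
    exact mul_le_of_le_one_right (zpow_nonneg (norm_nonneg _) _) ho
  · rw [norm_zpow]
    calc ‖w‖ * ‖(ϖ : K)‖ ≤ ‖(ϖ : K)‖ ^ (n₀ - 1) * ‖(ϖ : K)‖ := mul_le_mul_of_nonneg_right hwle (norm_nonneg _)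
      _ = ‖(ϖ : K)‖ ^ n₀ := by rw [← zpow_add_one₀ h0.ne', sub_add_cancel]

/-- **Certified LOWER bound on the inner radius**: if `1/(p−1) < r/e` for an integer `r` (e.g. `r = ⌊e/(p−1)⌋ + 1`), then every maximal
inner radius `c` as above has `p^{−r/e} ≤ ‖c‖` — because `p^{r/e}𝒪_K ⊆ log_p(𝒪_K^×)` (abc-iut-S1 / `pBall_subset_logUnits_of_lt`), the
witness `w ∉ log_p(𝒪_K^×)` has `‖w‖ > p^{−r/e}`, hence `‖w‖ ≥ p^{−(r−1)/e}` by discreteness of the value group, and `‖ϖ‖ = p^{−1/e}`.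
[cite: Mochizuki2012, IUTchIV Prop. 1.2 (i) p. 10] [claim: Mochizuki2012, status: disputed] -/
theorem rpow_le_norm_of_innerRadius {c w : K} {ϖ : Kˣ} (hϖ : IsUniformizer ϖ) (hw : w ∉ logUnits K)
    (hle : ‖w‖ * ‖(ϖ : K)‖ ≤ ‖c‖) {r : ℤ} (hr : 1 / ((p : ℝ) - 1) < (r : ℝ) / (absRamificationIdx p K : ℝ)) :
    (p : ℝ) ^ (-((r : ℝ) / (absRamificationIdx p K : ℝ))) ≤ ‖c‖ := by
  have hp1 : (1 : ℝ) < p := by exact_mod_cast (Fact.out : p.Prime).one_lt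
  have hp0 : (0 : ℝ) < p := by linarith
  have he0 : (0 : ℝ) < (absRamificationIdx p K : ℝ) := by exact_mod_cast absRamificationIdx_pos p K
  have hsub := pBall_subset_logUnits_of_lt p K hr
  have hw0 : w ≠ 0 := fun h => hw (h ▸ zero_mem_logUnits (p := p))
  obtain ⟨m, hm⟩ := exists_norm_eq_rpow p K hw0
  have hgt : (p : ℝ) ^ (-((r : ℝ) / (absRamificationIdx p K : ℝ))) < ‖w‖ := by
    by_contra hle'
    exact hw (hsub (by rw [mem_pBall_iff]; exact not_lt.mp hle'))
  rw [hm, Real.rpow_lt_rpow_left_iff hp1, neg_lt_neg_iff, div_lt_div_iff_of_pos_right he0] at hgt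
  have hmr : m + 1 ≤ r := by exact_mod_cast hgt
  calc (p : ℝ) ^ (-((r : ℝ) / (absRamificationIdx p K : ℝ)))
      ≤ (p : ℝ) ^ (-((((m + 1 : ℤ)) : ℝ) / (absRamificationIdx p K : ℝ))) := by
        refine Real.rpow_le_rpow_of_exponent_le hp1.le (neg_le_neg ?_)
        exact div_le_div_of_nonneg_right (by exact_mod_cast hmr) he0.le
    _ = (p : ℝ) ^ (-((m : ℝ) / (absRamificationIdx p K : ℝ))) * (p : ℝ) ^ (-(1 / (absRamificationIdx p K : ℝ))) := by
        rw [← Real.rpow_add hp0]; congr 1; push_cast; ring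
    _ = ‖w‖ * ‖(ϖ : K)‖ := by rw [hm, norm_eq_rpow_of_isUniformizer p K hϖ]
    _ ≤ ‖c‖ := hle

include p in
/-- **The OUTER radius of `log_p(𝒪_K^×)` exists** (an element of largest norm; abc-iut-w6's `exists_norm_le_norm_of_mem_logUnits`, restated in
the binder order `houtΛ/hout0/hdom` of the U2-LICENCE-WRAPPER). [cite: Mochizuki2012, IUTchIV Prop. 1.2 (i) p. 10] [claim: Mochizuki2012, status: disputed] -/
theorem exists_outerRadius : ∃ c : K, c ∈ logUnits K ∧ c ≠ 0 ∧ ∀ z ∈ logUnits K, ‖z‖ ≤ ‖c‖ := by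
  obtain ⟨c, hc, h0, hdom⟩ := exists_norm_le_norm_of_mem_logUnits p K
  exact ⟨c, hc, h0, hdom⟩

/-- **Certified UPPER bound on the outer radius** at the turning point `a₀` (`p^a(p−1) < e` for `a < a₀`, `e ≤ p^{a₀}(p−1)`): every
`c ∈ log_p(𝒪_K^×)` has `‖c‖ ≤ p^{−r♯/e}` with `r♯ = p^{a₀} − a₀·e = min_t (p^t − t·e)` (abc-iut-rp-x2's `norm_le_rpow_sharp_of_mem_logUnits`,
exponent rewritten in `e`-units). [cite: NeukirchANT1999, Ch. II (5.5)] -/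
theorem norm_le_rpow_of_mem_logUnits_turning {a₀ : ℕ}
    (hlo : ∀ a < a₀, (1 : ℤ) * (p : ℤ) ^ a * ((p : ℤ) - 1) < absRamificationIdx p K)
    (hhi : (absRamificationIdx p K : ℤ) ≤ 1 * (p : ℤ) ^ a₀ * ((p : ℤ) - 1)) {c : K} (hc : c ∈ logUnits K) :
    ‖c‖ ≤ (p : ℝ) ^ ((((-((p : ℤ) ^ a₀ - (a₀ : ℤ) * (absRamificationIdx p K : ℤ))) : ℤ) : ℝ) /
      (((absRamificationIdx p K : ℕ) : ℤ) : ℝ)) := by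
  have h := norm_le_rpow_sharp_of_mem_logUnits p K hlo hhi hc
  have he0 : (absRamificationIdx p K : ℝ) ≠ 0 := by exact_mod_cast (absRamificationIdx_pos p K).ne'
  convert h using 2
  push_cast
  field_simp

end Local

end HexHullThreshold

/-! ## §2. The ENGINE at the genuine `K`-line: row 4's column FAILS at the chosen place ⟹ S_H fails -/

section Engine

open Thm311 Thm311.Real Cor312 Cor312Vol Cor312Prov Literature.IUT.LogThetaLattice Literature.IUT.LogVolume
  Literature.IUT.HodgeTheaters Literature.IUT.LogVolume.ThetaData
  Literature.NumberTheory.NumberFields Literature.NumberTheory.DiophantineGeometry.GenEll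
  Literature.NumberTheory.DiophantineGeometry Summit.ABC.ABC.Theorems Literature.NumberTheory.GaloisRepresentations.Ultrametric
  Summit.ABC.IUTFork.Repair.RH.HullThresholdExact Summit.ABC.IUTFork.Repair.RH.HullThresholdExactRefute

/-- `b^x = b^y ⟹ x = y` for a real base `b > 1`. [folklore] -/
private theorem rpow_right_inj_of_one_lt {b x y : ℝ} (hb : 1 < b) (h : b ^ x = b ^ y) : x = y :=
  le_antisymm ((Real.rpow_le_rpow_left_iff hb).mp h.le) ((Real.rpow_le_rpow_left_iff hb).mp h.ge)

/-- **ENGINE — GENUINE-NEG THROUGH ROW 4's FLOOR-EXACT HULL THRESHOLD.** `k ≥ 1`, `l ≥ 11` prime, `l ∤ k`, a label `i + 1 ≤ l⋇`, a genuine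
Θ-volume datum `T` over `(ratPoint λ_k, l)` whose places `x₀ | 7` all have `e(K_{x₀}/ℚ_7) ∣ B·l` (`B = 15` for even `k`:
`GenuineK.localType_lamSeven_fifteen`; `B = 30` always: `GenuineK.localType_lamSeven_thirty`), and for EVERY `d ∣ B` the column of R-H row 4
FAILS at the would-be local type `e = l·d`: `¬ HullCell (l·d) (k·d) (i+1) (⌊l·d/6⌋+1) (7^{a₀} − a₀·l·d)`, `a₀` the turning point of `e`. THEN, for
EVERY choice of the free context binders and Kummer data, `Cor312Vol.PilotKummerCompatHull` at `settingPrVolSharp (pilotDataOfK T.D T.K) …`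
with the CHOSEN realising ideles and the PINNED reading FAILS. Proof BY NAME: `GenuineK.exists_place_lamSeven` (bad, tame, `‖t_q(x₀)‖ = 7^{−k/l}`),
`exists_norm_eq_rpow` (`l ∣ e`), `norm_qIdele_eq_rpow_of_realises` (`P_q = k·d`), §1 at every `(p, x)`, `differentOrd_eq_of_not_dvd` +
`differentOrd_le_differentOrd_dFac`, `not_licence_settingPrVolSharp_of_not_hullCell` (p462895), `licence_of_pilotKummerCompatHull`. Sharp reading;
refuted-as-typed only; nothing about the number-level Corollary. [cite: Mochizuki2012, IUTchIII Cor. 3.12 Step (xi-f) p. 184; IUTchIV Prop. 1.1 p. 9, Prop. 1.2 (i)(ii) p. 10]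
[cite: DupuyHilado2025, §3.4, §4.9, §4.12] [cite: SerreLocalFields1979, Ch. III §6 Prop. 13] [claim: Mochizuki2012, status: disputed] -/
theorem GenuineK.not_pilotKummerCompatHull_lamSeven_of_not_hullCell {k l B : ℕ} (hk : 1 ≤ k) (hl : l.Prime) (h11 : 11 ≤ l)
    (hlk : ¬ l ∣ k) {i : ℕ} (hi : i + 1 ≤ (l - 1) / 2)
    (T : Cor22.ThetaVolumeDatumAt (ratPoint ((2 : ℚ)⁻¹ + 2 / 7 ^ k)) l)
    (hloc : letI := T.instFieldF; letI := T.instNumberFieldF; letI := T.instAlgebraF; letI := T.instFieldK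
      letI := T.instNumberFieldK; letI := T.instAlgebraK; letI := T.instFieldFbar; letI := T.instAlgebraFbar
      letI := T.instAlgebraKFbar; letI := T.instIsElliptic
      haveI : Fact (Nat.Prime 7) := ⟨by norm_num⟩
      ∀ x₀ : (thetaIndex (pilotDataOfK T.D T.K)).Fibre (.inr ⟨7, by norm_num⟩),
        absRamificationIdx 7 (kOf (pilotDataOfK T.D T.K) 7 x₀) ∣ B * l)
    (hcell : ∀ d : ℕ, d ∣ B → ∃ a₀ : ℕ, (∀ a, a < a₀ → (1 : ℤ) * (7 : ℤ) ^ a * ((7 : ℤ) - 1) < ((l * d : ℕ) : ℤ)) ∧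
      ((l * d : ℕ) : ℤ) ≤ 1 * (7 : ℤ) ^ a₀ * ((7 : ℤ) - 1) ∧
      ¬ HullCell ((l * d : ℕ) : ℤ) ((k * d : ℕ) : ℤ) ((i : ℤ) + 1) ((l * d / 6 + 1 : ℕ) : ℤ)
        ((7 : ℤ) ^ a₀ - (a₀ : ℤ) * ((l * d : ℕ) : ℤ))) :
    letI := T.instFieldF; letI := T.instNumberFieldF; letI := T.instAlgebraF; letI := T.instFieldK
    letI := T.instNumberFieldK; letI := T.instAlgebraK; letI := T.instFieldFbar; letI := T.instAlgebraFbar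
    letI := T.instAlgebraKFbar; letI := T.instIsElliptic
    ∀ (M : Type) [Field M] [NumberField M]
      (archPk : ∀ (j : (thetaIndex (pilotDataOfK T.D T.K)).Label) (vQ : (thetaIndex (pilotDataOfK T.D T.K)).VQ),
        Set ((logShellsDH (pilotDataOfK T.D T.K) (analyticLogv T.K)).Packet j vQ))
      (archSub : ∀ (j : (thetaIndex (pilotDataOfK T.D T.K)).Label) (v : (thetaIndex (pilotDataOfK T.D T.K)).V),
        Set ((logShellsDH (pilotDataOfK T.D T.K) (analyticLogv T.K)).Packet j ((thetaIndex (pilotDataOfK T.D T.K)).over v)))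
      (Ψ : ℤ → ∀ v : (thetaIndex (pilotDataOfK T.D T.K)).V, v ∈ (thetaIndex (pilotDataOfK T.D T.K)).Vbad →
        Set ((logShellsDH (pilotDataOfK T.D T.K) (analyticLogv T.K)).StarPacket v))
      (act : ℤ → ∀ v : (thetaIndex (pilotDataOfK T.D T.K)).V, v ∈ (thetaIndex (pilotDataOfK T.D T.K)).Vbad →
        (logShellsDH (pilotDataOfK T.D T.K) (analyticLogv T.K)).StarPacket v →
          Module.End ℚ ((logShellsDH (pilotDataOfK T.D T.K) (analyticLogv T.K)).StarPacket v))
      (Mmod : ℤ → ∀ j : (thetaIndex (pilotDataOfK T.D T.K)).LabelStar,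
        Set ((logShellsDH (pilotDataOfK T.D T.K) (analyticLogv T.K)).GlobalPacket j.1))
      (region : ℤ → ∀ j : (thetaIndex (pilotDataOfK T.D T.K)).LabelStar, FinDivisor M →
        ∀ vQ : (thetaIndex (pilotDataOfK T.D T.K)).VQ, Set ((logShellsDH (pilotDataOfK T.D T.K) (analyticLogv T.K)).Packet j.1 vQ))
      (frobAdm : ℤ → ℤ → ∀ (j : (thetaIndex (pilotDataOfK T.D T.K)).Label) (vQ : (thetaIndex (pilotDataOfK T.D T.K)).VQ),
        Set ((logShellsDH (pilotDataOfK T.D T.K) (analyticLogv T.K)).Packet j vQ) → Prop)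
      (frobLogvol : ℤ → ℤ → ∀ (j : (thetaIndex (pilotDataOfK T.D T.K)).Label) (vQ : (thetaIndex (pilotDataOfK T.D T.K)).VQ),
        Set ((logShellsDH (pilotDataOfK T.D T.K) (analyticLogv T.K)).Packet j vQ) → ℝ)
      (frobΨ : ℤ → ℤ → ∀ v : (thetaIndex (pilotDataOfK T.D T.K)).V, v ∈ (thetaIndex (pilotDataOfK T.D T.K)).Vbad →
        Set ((logShellsDH (pilotDataOfK T.D T.K) (analyticLogv T.K)).StarPacket v))
      (frobMmod : ℤ → ℤ → ∀ j : (thetaIndex (pilotDataOfK T.D T.K)).LabelStar,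
        Set ((logShellsDH (pilotDataOfK T.D T.K) (analyticLogv T.K)).GlobalPacket j.1))
      (unitImage : ℤ → ℤ → ℕ → ∀ (j : (thetaIndex (pilotDataOfK T.D T.K)).Label) (vQ : (thetaIndex (pilotDataOfK T.D T.K)).VQ),
        Set ((logShellsDH (pilotDataOfK T.D T.K) (analyticLogv T.K)).Packet j vQ))
      (ballImage : ℤ → ℤ → ∀ (j : (thetaIndex (pilotDataOfK T.D T.K)).Label) (vQ : (thetaIndex (pilotDataOfK T.D T.K)).VQ),
        Set ((logShellsDH (pilotDataOfK T.D T.K) (analyticLogv T.K)).Packet j vQ))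
      (thetaDiv : ℤ → ℤ → LgpDivisor M (thetaIndex (pilotDataOfK T.D T.K)).lstar)
      (n : ℤ) {HT : Type} {LogLink : HT → HT → Type} {IsFull : ∀ {s t : HT}, LogLink s t → Prop}
      (lat : LGPGaussianLogThetaLattice LogLink IsFull)
      {Frd : Type} {IsoF : Frd → Frd → Type} {Ob : Frd → Type} {realify : Frd → Frd} {Strip : Type}
      {IsoS : Strip → Strip → Type} {Mv : ∀ v : (thetaIndex (pilotDataOfK T.D T.K)).V, v ∈ (thetaIndex (pilotDataOfK T.D T.K)).Vbad → Type}
      [∀ v h, Monoid (Mv v h)]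
      (sig : GlobalLGPFrobenioidSignature (thetaIndex (pilotDataOfK T.D T.K)).lstar (thetaIndex (pilotDataOfK T.D T.K)).V
        (· ∈ (thetaIndex (pilotDataOfK T.D T.K)).Vbad) Frd IsoF Ob realify Strip IsoS Mv)
      (split : SplittingMonoids Mv) {ObΔ : Type}
      {N : ∀ v : (thetaIndex (pilotDataOfK T.D T.K)).V, v ∈ (thetaIndex (pilotDataOfK T.D T.K)).Vbad → Type}
      [∀ v h, Monoid (N v h)] (qData : QPilotData ObΔ N)
      (qK : ∀ v : (thetaIndex (pilotDataOfK T.D T.K)).V, v ∈ (thetaIndex (pilotDataOfK T.D T.K)).Vbad →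
        Set ((logShellsDH (pilotDataOfK T.D T.K) (analyticLogv T.K)).StarPacket v)),
    ¬ Cor312Vol.PilotKummerCompatHull
        (LatticeSituation.ofShells (logShellsDH (pilotDataOfK T.D T.K) (analyticLogv T.K)) M archPk archSub
          (summandPiecesPr (pilotDataOfK T.D T.K) (logvAnalytic_analyticLogv (F := T.K))).Adm
          (summandPiecesPr (pilotDataOfK T.D T.K) (logvAnalytic_analyticLogv (F := T.K))).logvol Ψ act Mmod region frobAdm
          frobLogvol frobΨ frobMmod unitImage ballImage thetaDiv)
        (settingPrVolSharp (pilotDataOfK T.D T.K) (logvAnalytic_analyticLogv (F := T.K)) M archPk archSub Ψ act Mmod region n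
          lat sig split qData (exists_realising_qIdeles_pilotDataOfK T.D).choose (exists_realising_thetaIdeles_pilotDataOfK T.D).choose
          (exists_realising_qIdeles_pilotDataOfK T.D).choose_spec.1 (exists_realising_qIdeles_pilotDataOfK T.D).choose_spec.2.1)
        (fun _ => Cor312.Setting.qRegion
          (settingPrVolSharp (pilotDataOfK T.D T.K) (logvAnalytic_analyticLogv (F := T.K)) M archPk archSub Ψ act Mmod region n
            lat sig split qData (exists_realising_qIdeles_pilotDataOfK T.D).choose (exists_realising_thetaIdeles_pilotDataOfK T.D).choose
            (exists_realising_qIdeles_pilotDataOfK T.D).choose_spec.1 (exists_realising_qIdeles_pilotDataOfK T.D).choose_spec.2.1))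
        qK := by
  letI := T.instFieldF; letI := T.instNumberFieldF; letI := T.instAlgebraF; letI := T.instFieldK
  letI := T.instNumberFieldK; letI := T.instAlgebraK; letI := T.instFieldFbar; letI := T.instAlgebraFbar
  letI := T.instAlgebraKFbar; letI := T.instIsElliptic
  intro M _ _ archPk archSub Ψ act Mmod region frobAdm frobLogvol frobΨ frobMmod
    unitImage ballImage thetaDiv n HT LogLink IsFull lat Frd IsoF Ob realify Strip IsoS Mv _ sig split ObΔ N _ qData qK hSH
  have hp7 : Nat.Prime 7 := by norm_num
  haveI h7 : Fact (Nat.Prime 7) := ⟨hp7⟩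
  have hL := licence_of_pilotKummerCompatHull (hq := fun _ _ => rfl) (hc := hSH)
  set X := pilotDataOfK T.D T.K with hXdef
  have hlog7 : LogvAnalytic (analyticLogv T.K) := logvAnalytic_analyticLogv (F := T.K)
  have htq0 := (exists_realising_qIdeles_pilotDataOfK T.D).choose_spec.1
  have htq := (exists_realising_qIdeles_pilotDataOfK T.D).choose_spec.2.2
  have ht0 := (exists_realising_thetaIdeles_pilotDataOfK T.D).choose_spec.1
  have ht := (exists_realising_thetaIdeles_pilotDataOfK T.D).choose_spec.2.2
  obtain ⟨x₀, -, htame, -, -, hnorm⟩ := GenuineK.exists_place_lamSeven hk hl h11 T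
  have h7r : (1 : ℝ) < 7 := by norm_num
  have hl0 : 0 < l := hl.pos
  have hl0r : (0 : ℝ) < l := by exact_mod_cast hl0
  set e : ℕ := absRamificationIdx 7 (kOf X 7 x₀) with he
  have he0 : 0 < e := absRamificationIdx_pos 7 _
  have he0r : (0 : ℝ) < e := by exact_mod_cast he0
  have heram : ramIdx T.K (placeOf X 7 x₀) = e := by
    rw [he, ramIdx_eq]
    exact (absRamificationIdx_rescaledCompletion T.K 7 (placeOf X 7 x₀) (natCast_mem_placeOf X 7 x₀)).symm
  -- `l ∣ e` from the value group
  obtain ⟨m, hm⟩ := exists_norm_eq_rpow 7 (kOf X 7 x₀) (htq0 ⟨7, hp7⟩ x₀)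
  rw [← he] at hm
  have hml : (m : ℝ) * l = (k : ℝ) * e := by
    have h1 := rpow_right_inj_of_one_lt h7r (hm.symm.trans hnorm)
    rw [neg_inj, div_eq_div_iff he0r.ne' hl0r.ne'] at h1
    linarith
  have hml' : m * (l : ℤ) = ((k * e : ℕ) : ℤ) := by exact_mod_cast hml
  have hdvd : l ∣ k * e := by
    have : (l : ℤ) ∣ ((k * e : ℕ) : ℤ) := ⟨m, by rw [← hml']; ring⟩
    exact_mod_cast this
  obtain ⟨d, hd⟩ : l ∣ e := ((Nat.Prime.dvd_mul hl).mp hdvd).resolve_left hlk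
  have hd0 : 0 < d := Nat.pos_of_ne_zero (by rintro rfl; simp at hd; omega)
  have hdB : d ∣ B := by
    have h1 : l * d ∣ l * B := by rw [← hd, mul_comm]; exact hloc x₀
    exact Nat.dvd_of_mul_dvd_mul_left hl0 h1
  obtain ⟨a₀, hlo, hhi, hneg⟩ := hcell d hdB
  have hq := norm_qIdele_eq_rpow_of_realises X (exists_realising_qIdeles_pilotDataOfK T.D).choose htq0 htq ⟨7, hp7⟩ x₀
  have hP : X.qPilot (placeOf X 7 x₀) = ((k * d : ℕ) : ℝ) := by
    have h1 := rpow_right_inj_of_one_lt h7r (hq.symm.trans hnorm)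
    rw [heram, hd] at h1
    have h1' : -X.qPilot (placeOf X 7 x₀) / ((l * d : ℕ) : ℝ) = -((k : ℝ) / l) := h1
    have hld0 : (0 : ℝ) < ((l * d : ℕ) : ℝ) := by rw [← hd]; exact he0r
    rw [div_eq_iff hld0.ne'] at h1'
    push_cast at h1' ⊢
    field_simp at h1'
    linear_combination -h1'
  have hIn : ∀ (pp : Nat.Primes) (x : (thetaIndex X).Fibre (.inr pp)),
      haveI : Fact (pp : ℕ).Prime := ⟨pp.2⟩
      ∃ (c : (presAt X hlog7 pp).k x) (ϖ : ((presAt X hlog7 pp).k x)ˣ) (w : (presAt X hlog7 pp).k x), c ≠ 0 ∧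
        (∀ o : (presAt X hlog7 pp).k x, ‖o‖ ≤ 1 → c * o ∈ logUnits ((presAt X hlog7 pp).k x)) ∧
        IsUniformizer ϖ ∧ w ∉ logUnits ((presAt X hlog7 pp).k x) ∧ ‖w‖ * ‖(ϖ : (presAt X hlog7 pp).k x)‖ ≤ ‖c‖ := fun pp x => by
    haveI : Fact (pp : ℕ).Prime := ⟨pp.2⟩
    exact HexHullThreshold.exists_innerRadius (pp : ℕ) ((presAt X hlog7 pp).k x)
  choose cin ϖ w hin0 hin hunif hw hwle using hIn
  have hOut : ∀ (pp : Nat.Primes) (x : (thetaIndex X).Fibre (.inr pp)),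
      haveI : Fact (pp : ℕ).Prime := ⟨pp.2⟩
      ∃ c : (presAt X hlog7 pp).k x, c ∈ logUnits ((presAt X hlog7 pp).k x) ∧ c ≠ 0 ∧
        ∀ z ∈ logUnits ((presAt X hlog7 pp).k x), ‖z‖ ≤ ‖c‖ := fun pp x => by
    haveI : Fact (pp : ℕ).Prime := ⟨pp.2⟩
    exact HexHullThreshold.exists_outerRadius (pp : ℕ) ((presAt X hlog7 pp).k x)
  choose cout houtΛ hout0 hdom using hOut
  have hlstar : (thetaIndex X).lstar = (l - 1) / 2 := rfl
  have hil : i < (thetaIndex X).lstar := by rw [hlstar]; omega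
  have hek : absRamificationIdx 7 ((presAt X hlog7 (⟨7, hp7⟩ : Nat.Primes)).k x₀) = l * d := hd
  have htame' : ¬ 7 ∣ absRamificationIdx 7 ((presAt X hlog7 (⟨7, hp7⟩ : Nat.Primes)).k x₀) := by rw [hek, ← hd]; exact htame
  have heram' : (ramIdx T.K (placeOf X 7 x₀) : ℤ) = ((l * d : ℕ) : ℤ) := by rw [heram, hd]
  refine not_licence_settingPrVolSharp_of_not_hullCell X hlog7 M archPk archSub Ψ act Mmod region n lat sig split qData
    (exists_realising_qIdeles_pilotDataOfK T.D).choose (exists_realising_thetaIdeles_pilotDataOfK T.D).choose htq0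
    (exists_realising_qIdeles_pilotDataOfK T.D).choose_spec.2.1 ht0 ht htq cin cout hin0 hin (fun pp x => ⟨ϖ pp x, w pp x, hunif pp x, hw pp x, hwle pp x⟩) hout0 houtΛ hdom
    ⟨7, hp7⟩ ⟨i, hil⟩ x₀ (P := k * d) (rinUb := ((l * d / 6 + 1 : ℕ) : ℤ))
    (routLb := (7 : ℤ) ^ a₀ - (a₀ : ℤ) * ((l * d : ℕ) : ℤ)) hP ?_ ?_ ?_ ?_ hL
  · -- hcin: `7^{−r_in/e} ≤ ‖cin x₀‖`
    have hr : 1 / (((7 : ℕ) : ℝ) - 1) < ((((l * d / 6 + 1 : ℕ) : ℤ)) : ℝ) /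
        (absRamificationIdx 7 ((presAt X hlog7 (⟨7, hp7⟩ : Nat.Primes)).k x₀) : ℝ) := by
      rw [hek]
      have h6 : l * d < 6 * (l * d / 6 + 1) := Nat.lt_mul_div_succ (l * d) (by norm_num)
      have hld0 : (0 : ℝ) < ((l * d : ℕ) : ℝ) := by rw [← hd]; exact he0r
      rw [lt_div_iff₀ hld0]
      have h6r : (((l * d : ℕ)) : ℝ) < 6 * (((l * d / 6 + 1 : ℕ)) : ℝ) := by exact_mod_cast h6
      have h16 : (1 : ℝ) / (((7 : ℕ) : ℝ) - 1) = 1 / 6 := by norm_num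
      rw [h16]
      simp only [Int.cast_natCast]
      push_cast at h6r ⊢
      linarith
    have h := HexHullThreshold.rpow_le_norm_of_innerRadius 7 _ (hunif _ x₀) (hw _ x₀) (hwle _ x₀) hr
    rw [hek] at h
    rw [heram']
    convert h using 2
    push_cast
    ring
  · -- hcout: `‖cout x₀‖ ≤ 7^{−r_out/e}`
    have hlo' : ∀ a < a₀, (1 : ℤ) * ((7 : ℕ) : ℤ) ^ a * (((7 : ℕ) : ℤ) - 1) <
        absRamificationIdx 7 ((presAt X hlog7 (⟨7, hp7⟩ : Nat.Primes)).k x₀) := by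
      rw [hek]; exact fun a ha => hlo a ha
    have hhi' : (absRamificationIdx 7 ((presAt X hlog7 (⟨7, hp7⟩ : Nat.Primes)).k x₀) : ℤ) ≤
        1 * ((7 : ℕ) : ℤ) ^ a₀ * (((7 : ℕ) : ℤ) - 1) := by
      rw [hek]; exact hhi
    have h := HexHullThreshold.norm_le_rpow_of_mem_logUnits_turning 7 _ hlo' hhi' (houtΛ _ x₀)
    rw [hek] at h
    rw [heram']
    convert h using 2
    push_cast
    ring
  · -- hd: the different defect of the diagonal packet at a TAME place
    intro J
    have hcard : Fintype.card ((thetaIndex X).Caps (Setting.labelSucc ⟨i, hil⟩)) = i + 2 := by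
      rw [Fintype.card_fin]
      simp only [Setting.labelSucc, Fin.val_succ]
    have hdiff : differentOrd 7 ((presAt X hlog7 (⟨7, hp7⟩ : Nat.Primes)).k x₀) = (((l * d : ℕ) : ℝ) - 1) / ((l * d : ℕ) : ℝ) := by
      rw [differentOrd_eq_of_not_dvd 7 _ htame', hek]
    have hfac := differentOrd_le_differentOrd_dFac 7 ((presAt X hlog7 (⟨7, hp7⟩ : Nat.Primes)).kk
      (fun _ : (thetaIndex X).Caps (Setting.labelSucc ⟨i, hil⟩) => x₀)) (Fin.last _) J
    have hsum : dSum 7 ((presAt X hlog7 (⟨7, hp7⟩ : Nat.Primes)).kk (fun _ : (thetaIndex X).Caps (Setting.labelSucc ⟨i, hil⟩) => x₀)) =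
        ((i : ℝ) + 2) * differentOrd 7 ((presAt X hlog7 (⟨7, hp7⟩ : Nat.Primes)).k x₀) := by
      unfold dSum
      dsimp only [Cor312Vol.PadicPresentation.kk]
      rw [Finset.sum_const, Finset.card_univ, hcard, nsmul_eq_mul]
      push_cast
      ring
    rw [heram', hsum]
    have hfac' : differentOrd 7 ((presAt X hlog7 (⟨7, hp7⟩ : Nat.Primes)).k x₀) ≤
        differentOrd 7 (DFac 7 ((presAt X hlog7 (⟨7, hp7⟩ : Nat.Primes)).kk
          (fun _ : (thetaIndex X).Caps (Setting.labelSucc ⟨i, hil⟩) => x₀)) J) := hfac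
    rw [hdiff] at hfac' ⊢
    have hI : (((⟨i, hil⟩ : Fin (thetaIndex X).lstar) : ℕ) : ℤ) = (i : ℤ) := rfl
    rw [hI]
    push_cast at hfac' ⊢
    linear_combination hfac'
  · -- hneg: the column fails at `(e, P_q) = (l·d, k·d)`
    rw [heram']
    exact hneg

end Engine

end Summit.ABC.IUTFork.Conditional

end
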